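import Mathlib.Analysis.Analytic.Binomial
import HarnessLib

/-!
# Gegenbauer (ultraspherical) polynomials in bivariate homogeneous form

For a real parameter `λ` the Gegenbauer polynomials `C^λ_j` are defined by the generating
function `(1 - 2tρ + ρ²)^{-λ} = Σ_j C^λ_j(t) ρ^j` (Andrews–Askey–Roy (6.4.10)). Expanding
`(1 - ρ(2t - ρ))^{-λ}` binomially and collecting the coefficient of `ρ^j` gives the explicit
(monomial) form (AAR, derivation of (6.4.12))
`ρ^j C^λ_j(t) = Σ_{i+m=j} a_m(λ) C(m, i) (-ρ²)^i (2tρ)^{m-i}`, `a_m(λ) = (λ)_m / m!`,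
while the factorisation `1 - 2ρ cos θ + ρ² = (1 - ρe^{iθ})(1 - ρe^{-iθ})` gives the Fourier
form `ρ^j C^λ_j(cos θ) = Σ_{k+l=j} a_k(λ) a_l(λ) (ρe^{iθ})^k (ρe^{-iθ})^l` (AAR (6.4.11)).

We work with the **bivariate homogeneous polynomial** `P^λ_j(σ, π)` in a commutative
`ℝ`-algebra, so that `ρ^j C^λ_j(t) = P^λ_j(2tρ, ρ²)`:

* `gegenbauerA lam k = (λ)_k / k!`;
  `gegenbauerHom lam j σ π = Σ_{i+m=j} a_m C(m,i) (-π)^i σ^{m-i}` (monomial form);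
  `gegenbauerFourier lam j u v = Σ_{k+l=j} a_k a_l u^k v^l` (Fourier form);
* `gegenbauerHom_rec`, `gegenbauerFourier_rec`: the three-term recurrence
  `(j+2) P_{j+2} = (j+1+λ) σ P_{j+1} - (j+2λ) π P_j` (AAR (6.4.16), homogenized) for both forms,
  proved by explicit index shifts on `Finset.antidiagonal`;
* `gegenbauerFourier_eq_hom`: **`Σ_{k+l=j} a_k a_l u^k v^l = P^λ_j(u + v, uv)`** (same
  recurrence, same initial values) — the bridge between the analytically accessible Fourier
  form (a Cauchy product of two binomial series) and the monomial form.

The generating function on the region `p² ≤ q < 1` (`Σ_j P^λ_j(2p, q) = (1 - 2p + q)^{-λ}`) is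
in `GegenbauerGenerating`. Motivation: the zonal-harmonic expansion of the Neeb–Ólafsson ball
kernel `(1 - 2⟨x,y⟩ + ‖x‖²‖y‖²)^{-s/2}` (`Literature.Probability.LatticeModels`,
`SphereReflectionPositivity*`). Mathlib has no Gegenbauer polynomials (only Chebyshev,
Hermite, and `Polynomial.shiftedLegendre`); the tree's `LegendrePolynomials` is the case
`λ = 1/2` in Rodrigues form and is not connected here.

## References

* G. E. Andrews, R. Askey, R. Roy, *Special Functions*, CUP 1999, §6.4, (6.4.10)–(6.4.12),
  (6.4.16). [AndrewsAskeyRoy1999]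
-/

noncomputable section

open Finset
open scoped Nat

namespace Literature.Analysis.SpecialFunctions

/-! ### The coefficients `a_k(λ) = (λ)_k / k!` -/

/-- `a_k(λ) = (λ)_k / k!`, the Taylor coefficients of `(1 - z)^{-λ}` (`= multichoose λ k`).
[cite: AndrewsAskeyRoy1999, (6.4.11) (the coefficients (λ)_k/k!)] -/
def gegenbauerA (lam : ℝ) (k : ℕ) : ℝ := (ascPochhammer ℝ k).eval lam / k !

/-- `a_0 = 1`. [folklore] -/
theorem gegenbauerA_zero (lam : ℝ) : gegenbauerA lam 0 = 1 := by
  simp [gegenbauerA]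

/-- `a_1 = λ`. [folklore] -/
theorem gegenbauerA_one (lam : ℝ) : gegenbauerA lam 1 = lam := by
  simp [gegenbauerA]

/-- `(k+1) a_{k+1} = (λ + k) a_k`. [folklore] -/
theorem gegenbauerA_succ_mul (lam : ℝ) (k : ℕ) :
    gegenbauerA lam (k + 1) * (k + 1) = gegenbauerA lam k * (lam + k) := by
  simp only [gegenbauerA, ascPochhammer_succ_eval, Nat.factorial_succ, Nat.cast_mul,
    Nat.cast_add, Nat.cast_one]
  have hk : (k ! : ℝ) ≠ 0 := by exact_mod_cast Nat.factorial_ne_zero k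
  field_simp

variable {A : Type*} [CommRing A] [Algebra ℝ A]

/-! ### The two forms -/

/-- The **bivariate (homogenized) Gegenbauer polynomial**
`P^λ_j(σ, π) = Σ_{i+m=j} a_m(λ) C(m,i) (-π)^i σ^{m-i}` in a commutative `ℝ`-algebra, so that
`ρ^j C^λ_j(t) = P^λ_j(2tρ, ρ²)` (the pairs `(i, m)` with `i > m` contribute `0` thanks to the
binomial coefficient). [cite: AndrewsAskeyRoy1999, §6.4, derivation of (6.4.12)] -/
def gegenbauerHom (lam : ℝ) (j : ℕ) (σ π : A) : A :=
  ∑ x ∈ antidiagonal j,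
    (gegenbauerA lam x.2 * (x.2.choose x.1 : ℝ)) • ((-π) ^ x.1 * σ ^ (x.2 - x.1))

/-- The **Fourier form** `F^λ_j(u, v) = Σ_{k+l=j} a_k(λ) a_l(λ) u^k v^l` (with `u = ρe^{iθ}`,
`v = ρe^{-iθ}` this is `ρ^j C^λ_j(cos θ)`). [cite: AndrewsAskeyRoy1999, (6.4.11)] -/
def gegenbauerFourier (lam : ℝ) (j : ℕ) (u v : A) : A :=
  ∑ x ∈ antidiagonal j, (gegenbauerA lam x.1 * gegenbauerA lam x.2) • (u ^ x.1 * v ^ x.2)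

/-! ### Index-shift helpers on antidiagonals -/

section Shift

variable {M : Type*} [AddCommMonoid M] [Module ℝ M]

/-- `Σ_{x ∈ AD(n+1)} x₁ • g x = Σ_{x ∈ AD n} (x₁+1) • g (x₁+1, x₂)`. [folklore] -/
theorem sum_antidiagonal_fst_smul (n : ℕ) (g : ℕ × ℕ → M) :
    ∑ x ∈ antidiagonal (n + 1), (x.1 : ℝ) • g x =
      ∑ x ∈ antidiagonal n, ((x.1 : ℝ) + 1) • g (x.1 + 1, x.2) := by
  rw [Nat.sum_antidiagonal_succ]
  simp

/-- `Σ_{x ∈ AD(n+1)} x₂ • g x = Σ_{x ∈ AD n} (x₂+1) • g (x₁, x₂+1)`. [folklore] -/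
theorem sum_antidiagonal_snd_smul (n : ℕ) (g : ℕ × ℕ → M) :
    ∑ x ∈ antidiagonal (n + 1), (x.2 : ℝ) • g x =
      ∑ x ∈ antidiagonal n, ((x.2 : ℝ) + 1) • g (x.1, x.2 + 1) := by
  rw [Nat.sum_antidiagonal_succ']
  simp

/-- On `AD n`, `n • h = x₁ • h + x₂ • h`. [folklore] -/
theorem sum_antidiagonal_cast_smul (n : ℕ) (h : ℕ × ℕ → M) :
    ∑ x ∈ antidiagonal n, (n : ℝ) • h x =
      ∑ x ∈ antidiagonal n, (x.1 : ℝ) • h x + ∑ x ∈ antidiagonal n, (x.2 : ℝ) • h x := by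
  rw [← Finset.sum_add_distrib]
  refine Finset.sum_congr rfl fun x hx => ?_
  rw [mem_antidiagonal] at hx
  rw [← add_smul, ← hx, Nat.cast_add]

end Shift

/-! ### The three-term recurrence -/

/-- **Three-term recurrence, Fourier form**:
`(j+2) F_{j+2} = (j+1+λ)(u+v) F_{j+1} - (j+2λ) uv F_j` (coefficientwise
`(k+1)a_{k+1} = (λ+k)a_k`). [cite: AndrewsAskeyRoy1999, (6.4.16)] -/
theorem gegenbauerFourier_rec (lam : ℝ) (u v : A) (j : ℕ) :
    ((j : ℝ) + 2) • gegenbauerFourier lam (j + 2) u v =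
      ((j : ℝ) + 1 + lam) • ((u + v) * gegenbauerFourier lam (j + 1) u v) -
        ((j : ℝ) + 2 * lam) • (u * v * gegenbauerFourier lam j u v) := by
  -- LHS over AD(j+1)
  have hL : ((j : ℝ) + 2) • gegenbauerFourier lam (j + 2) u v =
      ∑ y ∈ antidiagonal (j + 1), ((lam + y.1) * (gegenbauerA lam y.1 * gegenbauerA lam y.2)) •
          (u ^ (y.1 + 1) * v ^ y.2) +
        ∑ y ∈ antidiagonal (j + 1), ((lam + y.2) * (gegenbauerA lam y.1 * gegenbauerA lam y.2)) •
          (u ^ y.1 * v ^ (y.2 + 1)) := by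
    unfold gegenbauerFourier
    rw [Finset.smul_sum, show ((j : ℝ) + 2) = ((j + 2 : ℕ) : ℝ) by push_cast; ring,
      sum_antidiagonal_cast_smul, sum_antidiagonal_fst_smul, sum_antidiagonal_snd_smul]
    congr 1
    · refine Finset.sum_congr rfl fun y _ => ?_
      simp only [smul_smul]
      congr 1
      linear_combination (gegenbauerA lam y.2) * gegenbauerA_succ_mul lam y.1
    · refine Finset.sum_congr rfl fun y _ => ?_
      simp only [smul_smul]
      congr 1
      linear_combination (gegenbauerA lam y.1) * gegenbauerA_succ_mul lam y.2
  -- RHS₂ over AD(j+1)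
  have hR : ((j : ℝ) + 2 * lam) • (u * v * gegenbauerFourier lam j u v) =
      ∑ y ∈ antidiagonal (j + 1), ((y.2 : ℝ) * (gegenbauerA lam y.1 * gegenbauerA lam y.2)) •
          (u ^ (y.1 + 1) * v ^ y.2) +
        ∑ y ∈ antidiagonal (j + 1), ((y.1 : ℝ) * (gegenbauerA lam y.1 * gegenbauerA lam y.2)) •
          (u ^ y.1 * v ^ (y.2 + 1)) := by
    have h1 : ∑ y ∈ antidiagonal (j + 1),
        ((y.2 : ℝ) * (gegenbauerA lam y.1 * gegenbauerA lam y.2)) •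
          (u ^ (y.1 + 1) * v ^ y.2) =
        ∑ z ∈ antidiagonal j, ((lam + z.2) * (gegenbauerA lam z.1 * gegenbauerA lam z.2)) •
          (u ^ (z.1 + 1) * v ^ (z.2 + 1)) := by
      rw [Finset.sum_congr rfl fun (y : ℕ × ℕ) _ => mul_smul (y.2 : ℝ)
        (gegenbauerA lam y.1 * gegenbauerA lam y.2) (u ^ (y.1 + 1) * v ^ y.2),
        sum_antidiagonal_snd_smul]
      refine Finset.sum_congr rfl fun z _ => ?_
      simp only [smul_smul]
      congr 1
      linear_combination (gegenbauerA lam z.1) * gegenbauerA_succ_mul lam z.2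
    have h2 : ∑ y ∈ antidiagonal (j + 1),
        ((y.1 : ℝ) * (gegenbauerA lam y.1 * gegenbauerA lam y.2)) •
          (u ^ y.1 * v ^ (y.2 + 1)) =
        ∑ z ∈ antidiagonal j, ((lam + z.1) * (gegenbauerA lam z.1 * gegenbauerA lam z.2)) •
          (u ^ (z.1 + 1) * v ^ (z.2 + 1)) := by
      rw [Finset.sum_congr rfl fun (y : ℕ × ℕ) _ => mul_smul (y.1 : ℝ)
        (gegenbauerA lam y.1 * gegenbauerA lam y.2) (u ^ y.1 * v ^ (y.2 + 1)),
        sum_antidiagonal_fst_smul]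
      refine Finset.sum_congr rfl fun z _ => ?_
      simp only [smul_smul]
      congr 1
      linear_combination (gegenbauerA lam z.2) * gegenbauerA_succ_mul lam z.1
    rw [h1, h2, ← Finset.sum_add_distrib]
    unfold gegenbauerFourier
    rw [Finset.mul_sum, Finset.smul_sum]
    refine Finset.sum_congr rfl fun z hz => ?_
    rw [mem_antidiagonal] at hz
    rw [← add_smul, mul_smul_comm, smul_smul,
      show ((j : ℝ) + 2 * lam) = (lam + z.2) + (lam + z.1) by
        rw [← hz, Nat.cast_add]; ring]
    congr 1
    · ring
    · ring
  rw [hL, eq_sub_iff_add_eq, hR]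
  unfold gegenbauerFourier
  rw [Finset.mul_sum, Finset.smul_sum, add_add_add_comm, ← Finset.sum_add_distrib,
    ← Finset.sum_add_distrib, ← Finset.sum_add_distrib]
  refine Finset.sum_congr rfl fun y hy => ?_
  rw [mem_antidiagonal] at hy
  have hj : ((j : ℝ) + 1) = y.1 + y.2 := by
    have := congrArg (Nat.cast (R := ℝ)) hy
    push_cast at this
    linarith
  rw [hj]
  simp only [Algebra.smul_def, map_add, map_mul, map_natCast, pow_succ]
  ring

/-- The scalar identity behind `gegenbauerHom_rec`:
`(j+2) a_{m+1} C(m+1,i+1) = (j+1+λ) a_m C(m,i+1) + (j+2λ) a_m C(m,i)` for `j = i + m`.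
[folklore] -/
theorem gegenbauerA_choose_rec (lam : ℝ) (i m : ℕ) :
    (((i + m : ℕ) : ℝ) + 2) * (gegenbauerA lam (m + 1) * ((m + 1).choose (i + 1) : ℝ)) =
      (((i + m : ℕ) : ℝ) + 1 + lam) * (gegenbauerA lam m * (m.choose (i + 1) : ℝ)) +
        (((i + m : ℕ) : ℝ) + 2 * lam) * (gegenbauerA lam m * (m.choose i : ℝ)) := by
  by_cases him : i ≤ m
  · obtain ⟨d, rfl⟩ := Nat.exists_eq_add_of_le him
    have e1 := gegenbauerA_succ_mul lam (i + d)
    have e2 : (((i + d).choose (i + 1) : ℕ) : ℝ) * (i + 1) = (((i + d).choose i : ℕ) : ℝ) * d := by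
      have := Nat.choose_succ_right_eq (i + d) i
      rw [Nat.add_sub_cancel_left] at this
      exact_mod_cast this
    have hC : (((i + d + 1).choose (i + 1) : ℕ) : ℝ) =
        ((i + d).choose i : ℝ) + ((i + d).choose (i + 1) : ℝ) := by
      rw [Nat.choose_succ_succ]
      push_cast
      ring
    have hm : ((i + d : ℕ) : ℝ) + 1 ≠ 0 := by positivity
    apply mul_left_cancel₀ hm
    rw [hC]
    push_cast at e1 ⊢
    linear_combination (2 * (i : ℝ) + d + 2) * ((((i + d).choose i : ℕ) : ℝ) +
      ((i + d).choose (i + 1) : ℝ)) * e1 + gegenbauerA lam (i + d) * (lam - 1) * e2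
  · have him' : m < i := not_le.1 him
    rw [Nat.choose_eq_zero_of_lt (by omega : m + 1 < i + 1),
      Nat.choose_eq_zero_of_lt (by omega : m < i + 1), Nat.choose_eq_zero_of_lt him']
    simp

/-- **Three-term recurrence, monomial form**:
`(j+2) P_{j+2} = (j+1+λ) σ P_{j+1} - (j+2λ) π P_j` (the Gegenbauer recurrence
`(n+1)C^λ_{n+1}(t) = 2(n+λ) t C^λ_n(t) - (n+2λ-1) C^λ_{n-1}(t)`, homogenized), by an explicit
index shift on the antidiagonal. [cite: AndrewsAskeyRoy1999, (6.4.16)] -/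
theorem gegenbauerHom_rec (lam : ℝ) (σ π : A) (j : ℕ) :
    ((j : ℝ) + 2) • gegenbauerHom lam (j + 2) σ π =
      ((j : ℝ) + 1 + lam) • (σ * gegenbauerHom lam (j + 1) σ π) -
        ((j : ℝ) + 2 * lam) • (π * gegenbauerHom lam j σ π) := by
  set T : ℕ × ℕ → A := fun x =>
    (gegenbauerA lam x.2 * (x.2.choose x.1 : ℝ)) • ((-π) ^ x.1 * σ ^ (x.2 - x.1)) with hT
  have hG : ∀ n, gegenbauerHom lam n σ π = ∑ x ∈ antidiagonal n, T x := fun n => rfl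
  have hA : gegenbauerHom lam (j + 2) σ π =
      T (0, j + 2) + ∑ z ∈ antidiagonal j, T (z.1 + 1, z.2 + 1) := by
    rw [hG, Nat.sum_antidiagonal_succ']
    have h0 : T (j + 2, 0) = 0 := by
      simp [hT, Nat.choose_eq_zero_of_lt (by omega : 0 < j + 2)]
    rw [h0, zero_add, Nat.sum_antidiagonal_succ]
  have hB : σ * gegenbauerHom lam (j + 1) σ π =
      σ * T (0, j + 1) + ∑ z ∈ antidiagonal j, σ * T (z.1 + 1, z.2) := by
    rw [hG, Nat.sum_antidiagonal_succ, mul_add, Finset.mul_sum]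
  have hTA : ∀ z : ℕ × ℕ, T (z.1 + 1, z.2 + 1) =
      (gegenbauerA lam (z.2 + 1) * ((z.2 + 1).choose (z.1 + 1) : ℝ)) •
        ((-π) ^ (z.1 + 1) * σ ^ (z.2 - z.1)) := by
    intro z
    simp only [hT, Nat.succ_sub_succ]
  have hTB : ∀ z : ℕ × ℕ, σ * T (z.1 + 1, z.2) =
      (gegenbauerA lam z.2 * (z.2.choose (z.1 + 1) : ℝ)) •
        ((-π) ^ (z.1 + 1) * σ ^ (z.2 - z.1)) := by
    intro z
    simp only [hT, mul_smul_comm]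
    by_cases h : z.1 + 1 ≤ z.2
    · congr 1
      rw [show z.2 - z.1 = z.2 - (z.1 + 1) + 1 by omega, pow_succ]
      ring
    · rw [Nat.choose_eq_zero_of_lt (by omega)]
      simp
  have hTC : ∀ z : ℕ × ℕ, π * T z =
      -((gegenbauerA lam z.2 * (z.2.choose z.1 : ℝ)) •
        ((-π) ^ (z.1 + 1) * σ ^ (z.2 - z.1))) := by
    intro z
    simp only [hT, mul_smul_comm, ← smul_neg]
    congr 1
    rw [pow_succ]
    ring
  have hbd : ((j : ℝ) + 2) • T (0, j + 2) = ((j : ℝ) + 1 + lam) • (σ * T (0, j + 1)) := by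
    simp only [hT, Nat.choose_zero_right, Nat.cast_one, mul_one, pow_zero, one_mul, Nat.sub_zero,
      smul_smul, mul_smul_comm]
    rw [show σ * σ ^ (j + 1) = σ ^ (j + 2) by ring]
    congr 1
    have := gegenbauerA_succ_mul lam (j + 1)
    push_cast at this
    linear_combination this
  rw [hA, hB, hG j, Finset.mul_sum, smul_add, smul_add, hbd, add_sub_assoc]
  congr 1
  rw [Finset.smul_sum, Finset.smul_sum, Finset.smul_sum, eq_sub_iff_add_eq,
    ← Finset.sum_add_distrib]
  refine Finset.sum_congr rfl fun z hz => ?_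
  rw [mem_antidiagonal] at hz
  rw [hTA, hTB, hTC, smul_neg, smul_smul, smul_smul, smul_smul, ← sub_eq_add_neg, ← sub_smul]
  congr 1
  have key := gegenbauerA_choose_rec lam z.1 z.2
  rw [hz] at key
  linear_combination key

/-! ### Fourier form = monomial form -/

/-- `F_0 = 1`. [folklore] -/
theorem gegenbauerFourier_zero (lam : ℝ) (u v : A) : gegenbauerFourier lam 0 u v = 1 := by
  simp [gegenbauerFourier, gegenbauerA_zero]

/-- `P_0 = 1`. [folklore] -/
theorem gegenbauerHom_zero (lam : ℝ) (σ π : A) : gegenbauerHom lam 0 σ π = 1 := by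
  simp [gegenbauerHom, gegenbauerA_zero]

/-- `F_1 = λ (u + v)`. [folklore] -/
theorem gegenbauerFourier_one (lam : ℝ) (u v : A) :
    gegenbauerFourier lam 1 u v = lam • (u + v) := by
  rw [gegenbauerFourier, Nat.sum_antidiagonal_succ]
  simp [gegenbauerA_zero, gegenbauerA_one, add_comm]

/-- `P_1 = λ σ`. [folklore] -/
theorem gegenbauerHom_one (lam : ℝ) (σ π : A) : gegenbauerHom lam 1 σ π = lam • σ := by
  rw [gegenbauerHom, Nat.sum_antidiagonal_succ]
  simp [gegenbauerA_zero, gegenbauerA_one]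

/-- **`Σ_{k+l=j} a_k a_l u^k v^l = P^λ_j(u + v, uv)`**: the Fourier form of the Gegenbauer
polynomial equals its monomial form at `σ = u + v`, `π = uv` (both satisfy the three-term
recurrence with the same initial values). With `u = ρe^{iθ}`, `v = ρe^{-iθ}` this is AAR's
(6.4.11) = (6.4.12): `ρ^j C^λ_j(cos θ) = Σ_{k+l=j} a_k a_l ρ^j e^{i(k-l)θ}`.
[cite: AndrewsAskeyRoy1999, (6.4.11)–(6.4.12)] -/
theorem gegenbauerFourier_eq_hom (lam : ℝ) (u v : A) (j : ℕ) :
    gegenbauerFourier lam j u v = gegenbauerHom lam j (u + v) (u * v) := by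
  induction j using Nat.twoStepInduction with
  | zero => rw [gegenbauerFourier_zero, gegenbauerHom_zero]
  | one => rw [gegenbauerFourier_one, gegenbauerHom_one]
  | more k h0 h1 =>
    have hF := gegenbauerFourier_rec lam u v k
    have hG := gegenbauerHom_rec lam (u + v) (u * v) k
    rw [h0, h1] at hF
    have hc : ((k : ℝ) + 2) ≠ 0 := by positivity
    have := congrArg (fun w => ((k : ℝ) + 2)⁻¹ • w) (hF.trans hG.symm)
    simpa only [smul_smul, inv_mul_cancel₀ hc, one_smul] using this

/-- `gegenbauerHom` commutes with `algebraMap ℝ A`. [folklore] -/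
theorem gegenbauerHom_algebraMap (lam : ℝ) (j : ℕ) (σ π : ℝ) :
    gegenbauerHom lam j (algebraMap ℝ A σ) (algebraMap ℝ A π) =
      algebraMap ℝ A (gegenbauerHom lam j σ π) := by
  simp only [gegenbauerHom, map_sum, Algebra.smul_def, map_mul, map_pow, map_neg]
  rfl

end Literature.Analysis.SpecialFunctions

end
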